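import Literature.MathematicalPhysics.QuantumFieldTheory.Balaban1983to89.B8Thm2TorusMemberCatalogue

/-!
# `Balaban1983to89.B8Thm2TorusMemberWeighted` — the (B)-line bond junction, file c2a: A CONSTANT-LEVEL MEMBER OF THE k-LEVEL V1 FAMILY WITH ITS WEIGHT LAW
# EXPORTED (`w(ι) = c_f²·b₀·(L^{n})^{d+1}·(L^{n})^{-2}` on every index bond, all of level `n`) — the member at which the averaging closeness (c′) between def-Y's
# `Q*(U)aQ(U)` and the knit's `Q*aQ` ([B8] (1.58), `a = 1`) is to be proved: the flat normalisations agree iff `b₀ = 1`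

statement-level skeleton of published theorems with citation tags; proofs where landed; nothing here is a claim about the
Yang–Mills mass gap

Sub-row G-B8-T2S (unit `lit-balaban-t2s-1`, gen 7), RULING #10 road, crux (c′) (design `lit-balaban-t2s-1/g7/BLINE-DESIGN-g7.md` §1).  File A11
(`B8Thm2TorusMemberCatalogue.exists_constLev_member`) constructs, for every torus period `2L^T` and level `n`, a member with one empty top level, but exports only
`m, K, k, M_h, c_f`, the constant level and `β` onto — NOT its weight `w`, which its proof takes from the existential `globalBand_witness`.  The averaging junction
needs the weight: def-Y's `Q*(U)aQ(U) = Q(U)ᵀ·diag(w)·Q(U)` (counting-measure transpose, `Node00.OpsYDeltaA.qsK_eq_transpose`) is to be compared with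
`(c_fη)²·` the knit's `QQZdP = η⁻²L^{n(d−1)}·Q_nᵀQ_n` (flat reading of `B9Eq316AveragingTransposeZdPrinted.QQZdP`, [B8] (1.58) with `a = 1`), and the two agree at
`U₀ = 1` iff `w ≡ c_f²·L^{n(d+1)}·L^{-2n}` on the level-`n` index bonds, i.e. iff the band witness is taken AT `b₀` AND `b₀ = 1`.  This file re-issues the member
with the explicit weight `w₀(ι) := b₀·(L^{j(ι)})^{d+1}·(L^{j(ι)})^{-2}` (times `c_f²`) and proves that every index bond of a constant-level-`n` member with nominal
index `n + 1` has level `j(ι) = n`.  Print: [B6] (2.3)–(2.4) p. 224, (2.16) p. 225, (2.18)–(2.20) p. 226; [4] (3.16) p. 393, (3.26) p. 395; [B8] (1.58) p. 86.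

WHAT IS PROVED (kernel, 0 sorry; theorems only, no `def`, no `… : Prop` fact, no `instance`).
* §1 `globalBand_explicit` — the explicit band weight `ι ↦ c_f²·b₀·(L^{j})^{d+1}·(1∕L^{j})²` lies in `GlobalBand b₀ b₁ c_f`.
* §1 ★★ `exists_constLev_member_weight` — A11's member (`i.m = T`, `i.K = 0`, `i.k = n + 1`, `M_h = L^a`, `c_f = L^{n+1}`, constant level `n`, `β` onto) WITH
  `∀ ι, i.w ι = i.cf²·(b₀·(L^{j(ι)})^{d+1}·(1∕L^{j(ι)})²)`.
* §2 ★ `ibondY_level_eq` — at any member of constant level `n` and nominal index `n + 1`, every index bond has level `n`; hence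
  ★ `weight_eq_of_constLev` — at the weighted member, `i.w ι = i.cf²·b₀·(L^{n})^{d+1}·(1∕L^{n})²` for EVERY index bond `ι`.

HONEST SCOPE.  Member bookkeeping only; nothing of [4] ∕ [B8]'s estimates; count-neutral; nothing continuum ∕ ℝ⁴ ∕ OS ∕ mass gap ∕ Clay — the Yang–Mills mass gap
is NOT proved here.  NEW file; A11 and the V1 charts are used BY NAME, nothing landed is modified.
-/

open scoped BigOperators

namespace Literature.MathematicalPhysics.QuantumFieldTheory.Balaban1983to89.B8Thm2TorusMemberWeighted

open Node00 B6KLevelCensusIndexV1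
open B5Eq118OneStroke (iterBlockOf)
open B15DeterminingSets (embIter)
open B6MultiLevelBoxOperator (N0)
open B6MultiLevelTorusOperator (TDomains)
open B6SectAOperatorsV1 (BondIdx)
open B6CubeWindowV1 (Placed GlobalBand placed_of_lt)
open B6Cover236MultiLevelBlocks (cubes)
open B6GlobalChartV1 (PV toBox domT iterBlockOf_mem_domT_iff)
open B6KLevelFamilyWitnessOddLV1 (exists_const_TDomains)
open B6KLevelFamilyWitnessV1 (N0_V1_pow)
open B6Ineq2142KLevelV1 (β)
open B8Thm2TorusMemberCatalogue (not_deep_of_constLev surjective_beta_of_constLev)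

variable {d ℓ : ℕ} {hd : 1 ≤ d + 1} {hL : Odd (ℓ + 1) ∧ 1 < ℓ + 1} {b₀ b₁ : ℝ}

/-! ## §1 The member with its weight law -/

section Member

variable {T Mh R n : ℕ} {P' : Fin (d + 1) → ℕ}

/-- **THE EXPLICIT BAND WEIGHT**: `ι ↦ c_f²·b₀·(L^{j})^{d+1}·(1∕L^{j})²` lies in the band (2.16) `GlobalBand b₀ b₁ c_f` (`0 < b₀ ≤ b₁`, `c_f ≠ 0`) — the witness
of `B6KLevelFamilyWitnessV1.globalBand_witness`, written out. [cite: Balaban1984PropagatorsII, (2.16) p.225] -/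
theorem globalBand_explicit {m K : ℕ} (Dm : B6SectADomainsV1.Domains (PV d ℓ m K hd hL)) (hb₁ : b₀ ≤ b₁) {cf : ℝ} (hcf : cf ≠ 0) :
    GlobalBand b₀ b₁ cf (fun ι : BondIdx Dm =>
      cf ^ 2 * (b₀ * ((((ℓ + 1 : ℕ) : ℝ)) ^ (ι.1.1 : ℕ)) ^ (d + 1) * (1 / (((ℓ + 1 : ℕ) : ℝ)) ^ (ι.1.1 : ℕ)) ^ 2)) := by
  intro ι
  have hL0 : (0 : ℝ) < (((ℓ + 1 : ℕ) : ℝ)) := by positivity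
  have hq : (((ℓ + 1 : ℕ) : ℝ)) ^ (ι.1.1 : ℕ) ≠ 0 := by positivity
  have hval : cf ^ 2 * (b₀ * ((((ℓ + 1 : ℕ) : ℝ)) ^ (ι.1.1 : ℕ)) ^ (d + 1) * (1 / (((ℓ + 1 : ℕ) : ℝ)) ^ (ι.1.1 : ℕ)) ^ 2) /
      (cf / (((ℓ + 1 : ℕ) : ℝ)) ^ (ι.1.1 : ℕ)) ^ 2 = b₀ * ((((ℓ + 1 : ℕ) : ℝ)) ^ (ι.1.1 : ℕ)) ^ (d + 1) := by
    field_simp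
  dsimp only
  rw [hval]
  exact ⟨le_rfl, mul_le_mul_of_nonneg_right hb₁ (by positivity)⟩

/-- ★★ **A11's CONSTANT-LEVEL MEMBER WITH ITS WEIGHT LAW EXPORTED**: for odd `L ≥ 5`, band `0 < b₀ ≤ b₁`, a level `n ≥ 1`, `L^a ≥ 8`, `s ≥ 1`, `T = n + a + 2 + s`:
a member `i` with `i.m = T`, `i.K = 0`, `i.k = n + 1`, `M_h = L^a`, `c_f = L^{n+1}`, constant level `n`, `β` onto, AND `i.w ι = c_f²·b₀·(L^{j(ι)})^{d+1}·(1∕L^{j(ι)})²`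
on every index bond. [cite: Balaban1984PropagatorsII, (2.1)–(2.4) p.224, (2.16) p.225, (2.18)–(2.20) p.226; Balaban1985BackgroundPropagators, (3.16) p.393, p.399] -/
theorem exists_constLev_member_weight (hℓ : 4 ≤ ℓ) (hb₀ : 0 < b₀) (hb₁ : b₀ ≤ b₁) {T n a s : ℕ} (hn : 1 ≤ n) (h8 : 8 ≤ (ℓ + 1) ^ a) (hs : 1 ≤ s)
    (hT : T = (n + 1) + a + 1 + s) :
    ∃ i : KIdx d ℓ hd hL b₀ b₁, i.m = T ∧ i.K = 0 ∧ i.k = n + 1 ∧ i.Mh = (ℓ + 1) ^ a ∧ i.cf = (((ℓ + 1 : ℕ) : ℝ)) ^ i.k ∧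
      (∀ x, i.D.lev x = n) ∧ Function.Surjective (β i.hN i.D i.hk) ∧
      ∀ ι, i.w ι = i.cf ^ 2 * (b₀ * ((((ℓ + 1 : ℕ) : ℝ)) ^ (ι.1.1 : ℕ)) ^ (d + 1) * (1 / (((ℓ + 1 : ℕ) : ℝ)) ^ (ι.1.1 : ℕ)) ^ 2) := by
  set P' : Fin (d + 1) → ℕ := fun _ => 2 * (ℓ + 1) ^ s with hP'
  have hLs : ℓ + 1 ≤ (ℓ + 1) ^ s := by
    calc ℓ + 1 = (ℓ + 1) ^ 1 := (pow_one _).symm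
      _ ≤ (ℓ + 1) ^ s := Nat.pow_le_pow_right (Nat.succ_pos ℓ) hs
  have hP5 : ∀ μ : Fin (d + 1), 5 ≤ P' μ := fun μ => by simp only [hP']; omega
  have hN : ∀ μ, N0 ℓ ((ℓ + 1) ^ a) (n + 1) P' μ = (PV d ℓ T 0 hd hL).sitesPerDir 0 :=
    fun μ => N0_V1_pow ℓ (n + 1) a s T 0 hd hL (by omega) μ
  have hk' : n + 1 ≤ T + 0 := by omega
  obtain ⟨D, hD⟩ := exists_const_TDomains d ℓ ((ℓ + 1) ^ a) (n + 1) P' (2 * (ℓ + 1) ^ 2) (j := n) hn (Nat.le_succ n)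
  have hpl : ∀ c : ↥(cubes D.toDomains), Placed ℓ (n + 1) P' c.1 := by
    intro c
    obtain ⟨x, _, hx⟩ := Finset.mem_image.1 c.2
    refine placed_of_lt hP5 c.1 ?_
    have h1 : c.1.1 = D.lev x := (congrArg Prod.fst hx).symm
    rw [h1, hD x]
    exact Nat.lt_succ_self n
  set cf : ℝ := (((ℓ + 1 : ℕ) : ℝ)) ^ (n + 1) with hcfdef
  have hcf : cf ≠ 0 := by positivity
  refine ⟨⟨T, 0, (ℓ + 1) ^ a, n + 1, 2 * (ℓ + 1) ^ 2, a, P', hN, D, hk', by omega, rfl, h8, le_rfl, hP5, hℓ, hpl,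
    cf, hcf, fun ι => cf ^ 2 * (b₀ * ((((ℓ + 1 : ℕ) : ℝ)) ^ (ι.1.1 : ℕ)) ^ (d + 1) * (1 / (((ℓ + 1 : ℕ) : ℝ)) ^ (ι.1.1 : ℕ)) ^ 2),
    fun ι => by positivity, globalBand_explicit (domT hN D hk') hb₁ hcf⟩,
    rfl, rfl, rfl, rfl, rfl, hD, surjective_beta_of_constLev hN D hk' hD, fun ι => rfl⟩

end Member

/-! ## §2 Every index bond of a constant-level member is of level `n` -/

section Level

variable (i : KIdx d ℓ hd hL b₀ b₁) {n : ℕ}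

/-- ★ **AT CONSTANT LEVEL `n` WITH NOMINAL INDEX `n + 1`, EVERY INDEX BOND HAS LEVEL `n`**: below `n` every block is deep (its `(j+1)`-block lies in
`Ω_{j+1} = T`), so `Λ_j` has no bonds; at `n + 1`, `Ω_{n+1}^{(n+1)} = ∅` carries no bond. [cite: Balaban1984PropagatorsII, (2.3)–(2.4) p.224, dictionary (charts)] -/
theorem ibondY_level_eq (hD : ∀ x, i.D.lev x = n) (hk : i.k = n + 1) (ι : IBondY i) : ((ι.1.1 : ℕ)) = n := by
  classical
  obtain ⟨⟨j, b⟩, hb⟩ := ι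
  have hj2 : (j : ℕ) < i.k + 1 := j.2
  have hjk : (j : ℕ) ≤ n + 1 := by omega
  obtain ⟨hOm, hsrc, -⟩ := hb
  show (j : ℕ) = n
  by_contra hne
  rcases lt_or_gt_of_ne hne with hlt | hgt
  · -- `j < n`: the source block is deep
    apply hsrc
    unfold B6SectADomainsV1.Domains.Deep
    have hj0 : (j : ℕ) + 1 ≠ 0 := by omega
    have hjk' : (j : ℕ) + 1 ≤ i.k := by omega
    simp only [domT, hj0, if_false, hjk', if_true, Finset.mem_filter, Finset.mem_univ, true_and]
    intro x _
    rw [hD]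
    omega
  · -- `j = n + 1`: `Ω_{n+1}` is empty
    have hj : (j : ℕ) = n + 1 := by omega
    have hempty : ∀ y : Site (PV d ℓ i.m i.K hd hL) (j : ℕ), y ∉ (domT i.hN i.D i.hk).Om (j : ℕ) := by
      intro y hy
      have hj0 : (j : ℕ) ≠ 0 := by omega
      have hjk' : (j : ℕ) ≤ i.k := by omega
      simp only [domT, hj0, if_false, hjk', if_true, Finset.mem_filter, Finset.mem_univ, true_and] at hy
      have hle : (j : ℕ) ≤ (PV d ℓ i.m i.K hd hL).m + (PV d ℓ i.m i.K hd hL).K := hjk'.trans i.hk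
      have h := hy (embIter (j : ℕ) y) (Node00.iterBlockOf_embIter (P := PV d ℓ i.m i.K hd hL) _ hle y)
      rw [hD] at h
      omega
    rcases hOm with h | h
    · exact hempty _ h
    · exact hempty _ h

/-- ★ **THE WEIGHT OF THE WEIGHTED MEMBER ON EVERY INDEX BOND**: `i.w ι = c_f²·b₀·(L^{n})^{d+1}·(1∕L^{n})²` (= `c_f²·b₀·L^{n(d−1)}`): with `b₀ = 1` exactly the
flat normalisation of the knit's `(c_fη)²·Q*aQ` ([B8] (1.58), `a = 1`). [cite: Balaban1984PropagatorsII, (2.16) p.225, (2.20) p.226; Balaban1985RegularSpaces, (1.58) p.86] -/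
theorem weight_eq_of_constLev (hD : ∀ x, i.D.lev x = n) (hk : i.k = n + 1)
    (hw : ∀ ι, i.w ι = i.cf ^ 2 * (b₀ * ((((ℓ + 1 : ℕ) : ℝ)) ^ (ι.1.1 : ℕ)) ^ (d + 1) * (1 / (((ℓ + 1 : ℕ) : ℝ)) ^ (ι.1.1 : ℕ)) ^ 2))
    (ι : IBondY i) : i.w ι = i.cf ^ 2 * (b₀ * ((((ℓ + 1 : ℕ) : ℝ)) ^ n) ^ (d + 1) * (1 / (((ℓ + 1 : ℕ) : ℝ)) ^ n) ^ 2) := by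
  rw [hw ι, ibondY_level_eq i hD hk ι]

end Level

end Literature.MathematicalPhysics.QuantumFieldTheory.Balaban1983to89.B8Thm2TorusMemberWeighted
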